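import Literature.AnabelianGeometry.EtaleTheta.Discharge.Sec1GenuineTorsorOfJointOrigin
import HarnessLib

/-!
# [EtTh] Thm 1.10 (iii)'s cusp datum from `ofStructureGroupIso`: the END-KNIT binders it meets BY CONSTRUCTION —
# (gen), C7e (1), the base splitting, and (sf) «`Ċ` is defined over `K`»

S. Mochizuki, *The étale theta function …* [EtTh], Publ. RIMS **45** (2009), Thm. 1.10 (iii) p. 30, Def. 1.7 p. 27 (`Π^tp_C` of the
orbicurve `C^log = X^log/±1` over `K`, augmentation onto `G_K`) [cite: MochizukiEtTh2009, Thm 1.10 (iii) p.30].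
abc-iut cell, layer L2, seat abc-iut-w5-d029 (gen 7); PROOF-ONLY sequel (no definition, no `Prop` fact, no instance) of p454786
(`DotCCusp.ofStructureGroupIso`) / p468879 / p470508.

The v3 END-KNIT closers of EtTh:Thm1.10(iii) (`thm110iiiGalSect_of_Xlevel_v3`, abc-iut-w5-d062) bind, per cusp datum `C`, besides (gen):
(sf) «`Ċ` is defined over `K`»: `∀ g : Π^tp_C, ∃ h : Π^tp_X, C.augC g = aug h`.  For the PRODUCED datum
`C := ofStructureGroupIso e εZ hx hD hS₀ κ` (augmentation `e.augC` of the C-level datum, of image `G_K` by the field `range_augC`) this is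
automatic:

* `MuTwoSetting.CLevelData.exists_aug_eq_augC` — `∀ g, ∃ h, e.augC g = aug h` (`range_augC` + `range_aug`);
* `MuTwoSetting.DotCCusp.hsf_ofStructureGroupIso` — (sf) for the produced datum;
* `MuTwoSetting.DotCCusp.exists_isGenuineTorsor_hsf_of_origins` — at a JOINT ORIGIN with `CuspLaws` and a C-level datum (p470508's
  hypotheses): `∃ C : M.DotCCusp εZ` over `(inclX D_x, inclX I_x)` with `C.IsGenuineTorsor ∧ C.IsCyclotomicInertia ∧ (sf)` — the binders
  (gen), C7e (1), (sf) of the closers are THEOREMS for the produced datum; what the closers still take from elsewhere is (x)/(ct)/F-0007/(b3).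

HONEST FRAMING: bookkeeping over the tree's constructions; origin predicates inhabited only at models; nothing of [EtTh] asserted; no side
taken on [IUTchIII] Cor. 3.12; typed ≠ proved.
-/

noncomputable section

namespace Literature.AnabelianGeometry.EtaleTheta.MuTwoSetting

open Literature.AnabelianGeometry.SemiGraphs GalSect
open scoped Pointwise

variable {p : ℕ} [Fact p.Prime] {M : MuTwoSetting p}

/-- **`augC(Π^tp_C) = aug(Π^tp_X)`** elementwise: for every `g ∈ Π^tp_C` there is `h ∈ Π^tp_X` with `augC g = aug h` (both
augmentations have image `G_K`: `range_augC`, `range_aug`). [cite: MochizukiEtTh2009, Def 1.7 p.27] -/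
theorem CLevelData.exists_aug_eq_augC (e : M.CLevelData) (g : M.GtpC) : ∃ h : M.PiTemp, e.augC g = M.aug h := by
  have hg : e.augC.toMonoidHom g ∈ M.aug.toMonoidHom.range := by
    rw [M.range_aug, show M.K.fixingSubgroup = M.GK from rfl, ← e.range_augC]
    exact ⟨g, rfl⟩
  obtain ⟨h, hh⟩ := hg
  exact ⟨h, hh.symm⟩

namespace DotCCusp

variable (e : M.CLevelData) (εZ : M.GtpC) {x : M.Pt} (hx : M.IsCusp x) (hD : M.decomp x ≤ M.GtpXdd)
  {S₀ : Subgroup M.PiTemp} (hS₀ : S₀ ∈ (cuspPairOf M.toTemperedCurve x).splittings)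

/-- **(sf) «`Ċ` is defined over `K`» for the produced cusp datum** `ofStructureGroupIso e εZ hx hD hS₀ κ` (its augmentation is
`e.augC`): the binder `hsfα`/`hsfβ` of the v3 END-KNIT closers, BY CONSTRUCTION. [cite: MochizukiEtTh2009, Thm 1.10 (iii) p.30] -/
theorem hsf_ofStructureGroupIso [T1Space M.GtpC]
    (κ : haveI := isMulCommutative_pushforward_I e hx
      haveI := ((cuspPairOf M.toTemperedCurve x).pushforward M.inclX).ID_normal
      KxHat M.toTemperedCurve ≃*
        ↥(ContH1.resKer ((cuspPairOf M.toTemperedCurve x).pushforward M.inclX).ID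
          (⊤ : Subgroup ((cuspPairOf M.toTemperedCurve x).pushforward M.inclX).D)
          (((cuspPairOf M.toTemperedCurve x).pushforward M.inclX).isClosedComplement_of_mem_splittings
            (map_inclX_mem_splittings e hS₀)).le_left)) :
    ∀ g : M.GtpC, ∃ h : M.PiTemp, (ofStructureGroupIso e εZ hx hD hS₀ κ).augC g = M.aug h :=
  fun g => e.exists_aug_eq_augC g

include hx hD in
/-- **At a JOINT ORIGIN: (gen), C7e (1) AND (sf) for one produced cusp datum.**  Under p470508's hypotheses (`IsEtThOrigin` + `hYcl` +
`IsThm16Origin` + `IsTateOrigin` + `CuspLaws`, a C-level datum `e`, a cusp `x` with (P3) and `D_x ≤ Π^tp_Ẍ`) there is `C : M.DotCCusp εZ`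
over `(inclX D_x, inclX I_x)` with `C.IsGenuineTorsor ∧ C.IsCyclotomicInertia ∧ ∀ g, ∃ h, C.augC g = aug h`.
[cite: MochizukiEtTh2009, Thm 1.10 (iii) p.30] -/
theorem exists_isGenuineTorsor_hsf_of_origins (hO : M.IsEtThOrigin)
    (hYcl : (M.DtpY.map M.toHat.toMonoidHom).topologicalClosure ≤
      M.DtpY.map M.toHat.toMonoidHom ⊔ (⁅⁅M.DeltaHat, M.DeltaHat⁆, M.DeltaHat⁆).topologicalClosure)
    (h16 : M.IsThm16Origin) (hT : M.IsTateOrigin) (hL : M.CuspLaws) (hP3 : M.decomp x ≤ M.GtpY) :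
    haveI := M.t1Space_GtpC e
    ∃ C : M.DotCCusp εZ, C.IsGenuineTorsor ∧ C.IsCyclotomicInertia ∧ (∀ g : M.GtpC, ∃ h : M.PiTemp, C.augC g = M.aug h) ∧
      C.pair = (cuspPairOf M.toTemperedCurve x).pushforward M.inclX := by
  haveI := M.t1Space_GtpC e
  obtain ⟨s, -, -, -, hS₀'⟩ := ThetaSetting.CuspLaws.exists_section_range_mem_splittings hL hx
  obtain ⟨κ⟩ := nonempty_kxHat_mulEquiv_resKer_pushforward_of_isCyclotomicCusp e hx hS₀'
    (M.toThetaSetting.isCyclotomicCusp_of_origins hO hYcl h16 hT hL hx hP3)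
    (ThetaSetting.CuspLaws.isCompact_decomp hL hx) (h16.map_aug_decomp_eq_GK hx hP3)
  refine ⟨ofStructureGroupIso e εZ hx hD hS₀' κ, isGenuineTorsor_ofStructureGroupIso e εZ hx hD hS₀' κ, ?_,
    hsf_ofStructureGroupIso e εZ hx hD hS₀' κ, rfl⟩
  change ((cuspPairOf M.toTemperedCurve x).pushforward M.inclX).IsCyclotomic e.augC.toMonoidHom
  rw [CuspPair.isCyclotomic_pushforward_iff _ M.continuous_inclX (M.isClosedEmbedding_inclX e).isEmbedding, augC_comp_inclX]
  exact M.toThetaSetting.isCyclotomicCusp_of_origins hO hYcl h16 hT hL hx hP3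

end DotCCusp

end Literature.AnabelianGeometry.EtaleTheta.MuTwoSetting

end
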